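import Mathlib
import HarnessLib
import Summits.ResolutionOfSingularities.ResolutionOfSingularities.Theorems.WildQuotientsWildQuotientResolutionJordanFiveSeamsAppLE
import Summits.ResolutionOfSingularities.ResolutionOfSingularities.Theorems.WildQuotientsWildQuotientResolutionJordanFourBrickH1W
import Summits.ResolutionOfSingularities.ResolutionOfSingularities.Theorems.WildQuotientsWildQuotientResolutionJordanFiveI12Stable

/-!
# RUNG V5 (`J₅`): the ring brick `H₁` (μ₃ piece on `chartW₁`) from a RING-SIDE statement in
# `B_{W₁} = (k[x][I₁₂t])_{(H′²t·T′²H′t²)}`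
(crux stmt-ResolutionOfSingularities-15640 `WildQuotients.WildQuotientResolution`, line `Sketch`;
chain w45c RUNG V5 B3+B4/HP₁ — the H₁ binder is the hypothesis `H₁` of res-L1-w45c-lead-1's
`JordanFive.coneBrick_one_of_ringBrick` (p532310) VERBATIM; twin of `brickH₂_of_ringSide`; support for
res-L1-w45c-stub-1's `brickHP1` / res-L1-w45c-stub-2's `exists_ringBrick_X1_model` (plan-1 RULING v8.3
(b), COORDINATION 13:00:46Z); written by res-D-pv-033 AS res-L1-w45c-stub-5 (standing offer o1).
[OURS · L1 W4.5c] — assembly of landed decls; NOT a statement of any manuscript.)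

`JordanFive.brickH₁_of_ringSide`: `H₁` follows from ANY ring-side brick in `B_{W₁}`: for every graded
family `φ` with the coefficient law, its powers clause at `s₁ = H′²t·T′²H′t²`, and all ratios
`t_j ∈ B_{W₁}` (`j ≠ 1`) with `(H′²/1)·t_j = g_j/1` — «`∃ R₀, J₀` radical, `Bl_{J₀}` regular, injective
`ψC : R₀ → B_{W₁}` onto the `φ`-fixed part, `√(ψC⁻¹⟨x_a/1,…,x_d/1, t_j⟩) = J₀`». PROOF: seam
`exists_sectionsEquiv_chartW₁_appLE` (p533847) + ONE `exact JordanFour.ringBrick_transport` (p519150).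
-/

-- single-problem summit: the doubled namespace component `ResolutionOfSingularities` is forced
set_option linter.dupNamespace false

noncomputable section

open CategoryTheory AlgebraicGeometry TopologicalSpace MvPolynomial Polynomial HomogeneousLocalization
open Literature.AlgebraicGeometry.Resolution Literature.AlgebraicGeometry.RelativeSpec
open scoped Pointwise

namespace Summit.ResolutionOfSingularities.ResolutionOfSingularities.Theorems.WildQuotientResolution.JordanFive

-- the statement is the literal `H₁` binder of p532310 (large chart / quotient terms): head-room
set_option maxHeartbeats 8000000 in
/-- **`H₁` from a ring side in `B_{W₁}`** (see the module docstring). [OURS · L1 W4.5c]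
[folklore; assembly of landed decls] -/
theorem brickH₁_of_ringSide (p : ℕ) (_hp : p.Prime) (_hp5 : 5 ≤ p)
    (k : Type) [Field k] [CharP k p] (n : ℕ)
    (σ : MvPolynomial (Fin n) k ≃ₐ[k] MvPolynomial (Fin n) k) [Finite ↥(Subgroup.zpowers σ)]
    (a b c d e : Fin n) (hab : a ≠ b) (hac : a ≠ c) (had : a ≠ d) (hae : a ≠ e) (hbc : b ≠ c)
    (hbd : b ≠ d) (hcd : c ≠ d)
    (hb : σ (X b) = X b + X a) (hc : σ (X c) = X c + X b) (hd : σ (X d) = X d + X c)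
    (hσ : ∀ i, i ≠ b → i ≠ c → i ≠ d → i ≠ e → σ (X i) = X i)
    (Hring : ∀ (φ : ↥(Subgroup.zpowers σ) → (reesGrading (I12 k n a b c d) →+*ᵍ reesGrading (I12 k n a b c d)))
      (_ : ∀ (g : ↥(Subgroup.zpowers σ)) x, ((φ g x : reesAlgebra (I12 k n a b c d)) : (MvPolynomial (Fin n) k)[X]) =
        (x : (MvPolynomial (Fin n) k)[X]).map ((MulSemiringAction.toRingEquiv
          (↥(Subgroup.zpowers σ)) (MvPolynomial (Fin n) k) g⁻¹ : _ ≃+* _) : _ →+* _))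
      (hP : ∀ g, Submonoid.powers (reesT (JordanFour.hPrime k n a b c ^ 2)
          (hPrime_sq_mem_I12 k n a b c d) * tSqHT2 k n a b c d) ≤
        (Submonoid.powers (reesT (JordanFour.hPrime k n a b c ^ 2)
          (hPrime_sq_mem_I12 k n a b c d) * tSqHT2 k n a b c d)).comap (φ g))
      (t : {j : Fin 40 // j ≠ 1} →
        HomogeneousLocalization.Away (reesGrading (I12 k n a b c d)) (reesT (JordanFour.hPrime k n a b c ^ 2)
          (hPrime_sq_mem_I12 k n a b c d) * tSqHT2 k n a b c d))
      (_ : ∀ j, ((fromZeroRingHom (reesGrading (I12 k n a b c d)) (.powers _)).comp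
          (reesGrading.zeroRingHom (I12 k n a b c d))) (JordanFour.hPrime k n a b c ^ 2) * t j =
        ((fromZeroRingHom (reesGrading (I12 k n a b c d)) (.powers _)).comp
          (reesGrading.zeroRingHom (I12 k n a b c d))) (gens12 k n a b c d j.1)),
      ∃ (R₀ : Type) (_ : CommRing R₀) (J₀ : Ideal R₀)
        (ψC : R₀ →+* HomogeneousLocalization.Away (reesGrading (I12 k n a b c d)) (reesT (JordanFour.hPrime k n a b c ^ 2)
          (hPrime_sq_mem_I12 k n a b c d) * tSqHT2 k n a b c d)),
        Function.Injective ψC ∧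
        (∀ y, y ∈ Set.range ψC ↔ ∀ g, HomogeneousLocalization.map (φ g) (hP g) y = y) ∧
        J₀.IsRadical ∧ Scheme.IsRegular (affineBlowup J₀) ∧
        ((Ideal.span (((fromZeroRingHom (reesGrading (I12 k n a b c d)) (.powers _)).comp
          (reesGrading.zeroRingHom (I12 k n a b c d))) '' {X a, X b, X c, X d} ∪ Set.range t)).comap
          ψC).radical = J₀) :
    ∀ (ρ : ↥(Subgroup.zpowers σ) →* Aut (Spec (CommRingCat.of (MvPolynomial (Fin n) k))))
      (hρ : ∀ g : ↥(Subgroup.zpowers σ), (ρ g).hom = Spec.map (CommRingCat.ofHom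
        ((MulSemiringAction.toRingEquiv (↥(Subgroup.zpowers σ)) (MvPolynomial (Fin n) k) g⁻¹ :
          MvPolynomial (Fin n) k ≃+* MvPolynomial (Fin n) k) :
            MvPolynomial (Fin n) k →+* MvPolynomial (Fin n) k)))
      (ρB : ActionOver
        (affineBlowup.π (I12 k n a b c d) ≫
          Spec.map (CommRingCat.ofHom (algebraMap
            (FixedPoints.subalgebra k (MvPolynomial (Fin n) k) (Subgroup.zpowers σ))
            (MvPolynomial (Fin n) k))))
        ↥(Subgroup.zpowers σ))
      (_ : ρB.aut = (affineBlowup.isBlowup (I12 k n a b c d)).liftAction ρ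
        (idealSheaf_I12_comap k n a b c d hab hac had hbc hbd hcd σ (hσ a hab hac had hae) hb hc hd
          ρ hρ))
      (O : ρB.StableAffineOpens) (_ : O.1 = chartW₁ k n a b c d)
      (hle : ((O.1.ι ≫ affineBlowup.π (I12 k n a b c d) ≫
          Spec.map (CommRingCat.ofHom (algebraMap
            (FixedPoints.subalgebra k (MvPolynomial (Fin n) k) (Subgroup.zpowers σ))
            (MvPolynomial (Fin n) k)))) ⁻¹ᵁ ⊤ : (O.1 : Scheme.{0}).Opens) ≤
        O.1.ι ⁻¹ᵁ blowupChart (affineBlowup.π (I12 k n a b c d))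
          (affineBlowup.idealSheaf (I12 k n a b c d)) ⟨⊤, isAffineOpen_top _⟩
          ((Scheme.ΓSpecIso (CommRingCat.of (MvPolynomial (Fin n) k))).inv.hom (JordanFour.hPrime k n a b c ^ 2)))
      (T : {j : Fin 40 // j ≠ 1} →
        Γ(affineBlowup (I12 k n a b c d), blowupChart (affineBlowup.π (I12 k n a b c d))
          (affineBlowup.idealSheaf (I12 k n a b c d)) ⟨⊤, isAffineOpen_top _⟩
          ((Scheme.ΓSpecIso (CommRingCat.of (MvPolynomial (Fin n) k))).inv.hom (JordanFour.hPrime k n a b c ^ 2))))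
      (_ : ∀ j, (affineBlowup.π (I12 k n a b c d)).appLE ⊤
            (blowupChart (affineBlowup.π (I12 k n a b c d))
              (affineBlowup.idealSheaf (I12 k n a b c d)) ⟨⊤, isAffineOpen_top _⟩
              ((Scheme.ΓSpecIso (CommRingCat.of (MvPolynomial (Fin n) k))).inv.hom (JordanFour.hPrime k n a b c ^ 2)))
            (blowupChart_le_preimage _ _ _ _)
            ((Scheme.ΓSpecIso (CommRingCat.of (MvPolynomial (Fin n) k))).inv.hom
              (gens12 k n a b c d j.1)) =
          (affineBlowup.π (I12 k n a b c d)).appLE ⊤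
            (blowupChart (affineBlowup.π (I12 k n a b c d))
              (affineBlowup.idealSheaf (I12 k n a b c d)) ⟨⊤, isAffineOpen_top _⟩
              ((Scheme.ΓSpecIso (CommRingCat.of (MvPolynomial (Fin n) k))).inv.hom (JordanFour.hPrime k n a b c ^ 2)))
            (blowupChart_le_preimage _ _ _ _)
            ((Scheme.ΓSpecIso (CommRingCat.of (MvPolynomial (Fin n) k))).inv.hom (JordanFour.hPrime k n a b c ^ 2)) * T j),
      ∃ (R₀ : Type) (_ : CommRing R₀) (J₀ : Ideal R₀)
        (ψ : R₀ →+* Γ((O.1 : Scheme.{0}), (O.1.ι ≫ affineBlowup.π (I12 k n a b c d) ≫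
          Spec.map (CommRingCat.ofHom (algebraMap
            (FixedPoints.subalgebra k (MvPolynomial (Fin n) k) (Subgroup.zpowers σ))
            (MvPolynomial (Fin n) k)))) ⁻¹ᵁ ⊤)),
        Function.Injective ψ ∧ ψ.range = (ρB.restrict O.1 O.2.1).invariantsRing ⊤ ∧
        J₀.IsRadical ∧ Scheme.IsRegular (affineBlowup J₀) ∧
        ((Ideal.span ((O.1.ι.appLE
            (blowupChart (affineBlowup.π (I12 k n a b c d))
              (affineBlowup.idealSheaf (I12 k n a b c d)) ⟨⊤, isAffineOpen_top _⟩
              ((Scheme.ΓSpecIso (CommRingCat.of (MvPolynomial (Fin n) k))).inv.hom (JordanFour.hPrime k n a b c ^ 2)))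
            ((O.1.ι ≫ affineBlowup.π (I12 k n a b c d) ≫
              Spec.map (CommRingCat.ofHom (algebraMap
                (FixedPoints.subalgebra k (MvPolynomial (Fin n) k) (Subgroup.zpowers σ))
                (MvPolynomial (Fin n) k)))) ⁻¹ᵁ ⊤) hle) ''
          (((affineBlowup.π (I12 k n a b c d)).appLE ⊤
              (blowupChart (affineBlowup.π (I12 k n a b c d))
                (affineBlowup.idealSheaf (I12 k n a b c d)) ⟨⊤, isAffineOpen_top _⟩
                ((Scheme.ΓSpecIso (CommRingCat.of (MvPolynomial (Fin n) k))).inv.hom (JordanFour.hPrime k n a b c ^ 2)))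
              (blowupChart_le_preimage _ _ _ _)) ''
            ((Scheme.ΓSpecIso (CommRingCat.of (MvPolynomial (Fin n) k))).inv ''
              {X a, X b, X c, X d}) ∪ Set.range T))).comap ψ).radical = J₀ := by
  intro ρ hρ ρB hρB O hO hle T hT
  have Hseam := exists_sectionsEquiv_chartW₁_appLE k n σ a b c d e hab hac had hae hb hc hd hσ
    (smul_I12_eq k n a b c d hab hac had hbc hbd hcd σ (hσ a hab hac had hae) hb hc hd) ρ hρ _ ρB hρB
    O hO hle
  rcases Hseam with ⟨φ, hP, Ω, hφ, hbase, -, hinv⟩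
  exact JordanFour.ringBrick_transport _ _ _ _ Ω hbase _ _ hinv (JordanFour.hPrime k n a b c ^ 2) _
    ({X a, X b, X c, X d} : Set (MvPolynomial (Fin n) k)) T hT (fun t ht => Hring φ hφ hP t ht)

end Summit.ResolutionOfSingularities.ResolutionOfSingularities.Theorems.WildQuotientResolution.JordanFive

end
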